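import Literature.NumberTheory.Automorphic.ArchEndoscopicChartOrbUnfoldLeavesGiven  -- ★ p851388 (this seat): the non-positive twins; brings ★ (α1), ★ `measure_chartBoxImg_pos`, ★ `isCompact_chartBoxImg`, ★ scaling
import HarnessLib

/-!
# UNIFORM UNFOLDING, PER-PLACE FORM, LEAVES AS HYPOTHESES — WITH A POSITIVE CONSTANT `K₀ > 0`
# ((JH-A-pos) of the LH3 (J)-H road: the jump constant `jcH S w₀ = (I K₀ ∕ (K₀′ · Ch)) · 2κ₀` must be NON-ZERO; Varadarajan 1989 §6.4, Shelstad 1979 §4, Folland 1995 §2.6)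

Topic `NumberTheory/Automorphic`; namespace `Literature.NumberTheory.Automorphic.UnitaryGroup`.  THEOREMS ONLY (no `def`, no instance, no axiom, no `sorry`).  Cell
`pub/hodgecm-mathlib`, crux H413 (`stmt-HodgeConjecture-24833`), line LH3 (closer stub `stub_N9`, DIRECT ROAD), organ L3′ forward half (J)-H, brick **(JH-A-pos)** (ask of the
final payer LH3-p03 (g6), 12:24:03Z: ★ (JH-asm)'s `hK₁ : K₁ ≠ 0`, `hK₂ : K₂ ≠ 0` with `K₁ := I·K₀`, `K₂ := K₀′·Ch` need `K₀, K₀′ ≠ 0`).  Author LH10-p02 (g7).  Count-neutral.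

WHAT.  The positive twins of ★ p851388's heads: **`exists_pos_archRH_mul_chartOrbH_eq_of_placeLeaves`** (product Haar convention) and **`…_of_isHaarMeasure`** — the same
hypotheses plus `∀ w, C_w ≠ 0` (the clause ★ `exists_placeLeaf` exports anyway), the same identity, and `0 < K₀`.  The constant of the assembly IS
`haarScalarFactor(νH, ν₀) · ρ(B_S) · Π_w C_w` — the Haar scalar is positive (★ `haarScalarFactor_pos_of_isHaarMeasure`), the product-quotient Haar measure `ρ` of the chart torus gives
the compact box `B_S` of non-empty interior a finite positive mass (★ `measure_chartBoxImg_pos`, ★ `isCompact_chartBoxImg`), and `Π_w C_w > 0`.  Proof = ★ p851388's, verbatim, with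
the constant's positivity recorded (the non-positive heads stay; these are strictly stronger twins).
HONEST LABEL: HC_CM is proved only modulo the 7 printed citations (2 remaining: hLiu418 = stmt-HodgeConjecture-24832, h413 = stmt-HodgeConjecture-24833) until rung 0
closes; measure-theoretic bookkeeping, pays nothing by itself.

## References
* [Varadarajan1989] V. S. Varadarajan, *An Introduction to Harmonic Analysis on Semisimple Lie Groups* (1989), §6.4 Lemma 21, Thm 23.
* [Shelstad1979] D. Shelstad, *Characters and inner forms of a quasi-split group over ℝ*, Compositio Math. 39 (1979), §4 pp. 22–25.
* [Folland1995] G. B. Folland, *A Course in Abstract Harmonic Analysis* (1995), §2.2; §2.6 Thm. 2.49, (2.52).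
* [BorelJacquet1979] A. Borel, H. Jacquet, *Automorphic forms and automorphic representations*, PSPM 33.1 (1979), §4.1.
-/

set_option autoImplicit false

noncomputable section

open MeasureTheory MeasureTheory.Measure NumberField NumberField.InfinitePlace Matrix Complex Topology Set
open Literature.MeasureTheory.Group Literature.NumberTheory.Automorphic.ArchCartan
open scoped MatrixGroups Matrix ENNReal NNReal ComplexConjugate Classical Pointwise

namespace Literature.NumberTheory.Automorphic.UnitaryGroup

local notation3 "Φ₂[" L "]" => (Matrix.of fun i j : Fin 2 => if i.val + j.val + 1 = 2 then (1 : L) else 0)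
local notation3 "Φ₁[" L "]" => (Matrix.of fun i j : Fin 1 => if i.val + j.val + 1 = 1 then (1 : L) else 0)
local notation3 "𝔸[" L "]" => ↥(arch (↥(maximalRealSubfield L)) L (IsCMField.complexConj L) 2 Φ₂[L])
local notation3 "𝔹[" L "]" => ↥(arch (↥(maximalRealSubfield L)) L (IsCMField.complexConj L) 1 Φ₁[L])

section Generic

/-- A measure carried by a leaf `Z` (null complement) on which a continuous map is proper AT THE RELEVANT COMPACTA is pushed forward to a measure finite on compacta (local
copy of the private helper of ★ (α1)). [folklore] -/
private theorem isFiniteMeasureOnCompacts_map_of_leaf_pos {X Y : Type*} [TopologicalSpace X] [MeasurableSpace X] [BorelSpace X] [TopologicalSpace Y] [T2Space Y]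
    [MeasurableSpace Y] [BorelSpace Y] (μ : Measure X) [IsFiniteMeasureOnCompacts μ] {Z : Set X} (hZ : μ Zᶜ = 0) {m : X → Y} (hm : Continuous m)
    (hprop : ∀ C : Set Y, IsCompact C → ∃ 𝒮 : Set X, IsCompact 𝒮 ∧ ∀ z ∈ Z, m z ∈ C → z ∈ 𝒮) : IsFiniteMeasureOnCompacts (μ.map m) := by
  refine ⟨fun C hC => ?_⟩
  obtain ⟨𝒮, h𝒮, h⟩ := hprop C hC
  rw [Measure.map_apply hm.measurable hC.measurableSet]
  have hsub : m ⁻¹' C ⊆ 𝒮 ∪ Zᶜ := fun z hz => by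
    by_cases hzZ : z ∈ Z
    · exact Or.inl (h z hzZ hz)
    · exact Or.inr hzZ
  calc μ (m ⁻¹' C) ≤ μ (𝒮 ∪ Zᶜ) := measure_mono hsub
    _ ≤ μ 𝒮 + μ Zᶜ := measure_union_le _ _
    _ < ⊤ := by rw [hZ, add_zero]; exact h𝒮.measure_lt_top

end Generic

/-! ## §1 The assembly for GIVEN leaves with a POSITIVE constant (product Haar convention) -/

section AssemblyPos

variable (L : Type) [Field L] [NumberField L] [IsCMField L] (S : Finset {w : InfinitePlace L // IsComplex w})
  [∀ w : {w : InfinitePlace L // IsComplex w}, MeasurableSpace ↥(archLocal L 2 Φ₂[L] w)]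
  [∀ w : {w : InfinitePlace L // IsComplex w}, BorelSpace ↥(archLocal L 2 Φ₂[L] w)]
  [∀ w : {w : InfinitePlace L // IsComplex w}, LocallyCompactSpace ↥(archLocal L 2 Φ₂[L] w)]
  [∀ w : {w : InfinitePlace L // IsComplex w}, SecondCountableTopology ↥(archLocal L 2 Φ₂[L] w)]
  [∀ w : {w : InfinitePlace L // IsComplex w}, MeasurableSpace (↥(archLocal L 2 Φ₂[L] w) ⧸ chartTorusHLoc L S w)]
  [∀ w : {w : InfinitePlace L // IsComplex w}, BorelSpace (↥(archLocal L 2 Φ₂[L] w) ⧸ chartTorusHLoc L S w)]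
  [∀ w : {w : InfinitePlace L // IsComplex w}, (chartHaarHLoc L S w).IsHaarMeasure]
  [∀ w : {w : InfinitePlace L // IsComplex w}, (chartHaarHLoc L S w).IsInvInvariant]
  [MeasurableSpace 𝔸[L]] [BorelSpace 𝔸[L]] [MeasurableSpace 𝔹[L]] [BorelSpace 𝔹[L]]
  (νw : ∀ w : {w : InfinitePlace L // IsComplex w}, Measure ↥(archLocal L 2 Φ₂[L] w)) [∀ w, (νw w).IsHaarMeasure] [∀ w, (νw w).IsMulRightInvariant]
  (νB : Measure 𝔹[L]) [νB.IsHaarMeasure] [νB.IsMulRightInvariant]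
  (νH : Measure (𝔸[L] × 𝔹[L])) [νH.IsHaarMeasure] [νH.IsMulRightInvariant]
  (hν : νH = ((Measure.pi νw).map (archPiEquivCM 2 L Φ₂[L]).symm).prod νB)

set_option maxHeartbeats 400000 in
include hν in
/-- **UNIFORM UNFOLDING FOR GIVEN LEAVES, WITH A POSITIVE CONSTANT (product Haar convention).**  As ★ `exists_archRH_mul_chartOrbH_eq_of_placeLeaves`, with the extra
hypothesis `∀ w, C_w ≠ 0` (★ `exists_placeLeaf`'s clause) and the extra conclusion `0 < K₀`: the constant IS `ρ(B_S) · Π_w C_w` for the product-quotient Haar measure `ρ` on the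
chart torus `T_S` and its compact box `B_S` of non-empty interior (★ `measure_chartBoxImg_pos`, ★ `isCompact_chartBoxImg`), every factor positive — what the (J)-H jump constant
`jcH S w₀ ≠ 0` (L3′ `BouazizSurjectiveStatement` conjunct 1) needs from the two charts' constants. [cite: Varadarajan1989, §6.4 Lemma 21, Thm 23] [cite: Shelstad1979, §4 pp. 22–25]
[cite: Folland1995, §2.6 (2.52)] [cite: BorelJacquet1979, §4.1] -/
theorem exists_pos_archRH_mul_chartOrbH_eq_of_placeLeaves
    (Λw : ∀ w : {w : InfinitePlace L // IsComplex w}, Measure (↥(archLocal L 2 Φ₂[L] w) × ↥(archLocal L 2 Φ₂[L] w))) [∀ w, IsFiniteMeasureOnCompacts (Λw w)]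
    (Zw : ∀ w : {w : InfinitePlace L // IsComplex w}, Set (↥(archLocal L 2 Φ₂[L] w) × ↥(archLocal L 2 Φ₂[L] w))) (hZnull : ∀ w, Λw w (Zw w)ᶜ = 0)
    (Cw : {w : InfinitePlace L // IsComplex w} → ℝ≥0) (hCw : ∀ w, Cw w ≠ 0)
    (hprop : ∀ (w) (c : {w : InfinitePlace L // IsComplex w} → Fin 3 → ℝ), c ∈ RegS S → ∀ C' : Set ↥(archLocal L 2 Φ₂[L] w), IsCompact C' →
      ∃ 𝒮 : Set (↥(archLocal L 2 Φ₂[L] w) × ↥(archLocal L 2 Φ₂[L] w)), IsCompact 𝒮 ∧ ∀ z ∈ Zw w, z.1 * (endoBlockAt L S w (c w) * z.2) * z.1⁻¹ ∈ C' → z ∈ 𝒮)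
    (hleaf : ∀ (w) (c : {w : InfinitePlace L // IsComplex w} → Fin 3 → ℝ), (w ∈ S → c w 0 ≠ 0) →
      Measure.map (descConj (endoBlockAt L S w (c w)) (chartTorusHLoc L S w) (forall_mem_chartTorusHLoc_comm L S w (c w)) id)
          (quotientMeasure (chartTorusHLoc L S w) (chartHaarHLoc L S w) (isClosed_chartTorusHLoc L S w) (νw w)) =
        (Cw w * (if w ∈ S then ‖(((Real.exp (-2 * c w 0) : ℝ) : ℂ)) - 1‖₊⁻¹ else 1)) •
          Measure.map (fun z : ↥(archLocal L 2 Φ₂[L] w) × ↥(archLocal L 2 Φ₂[L] w) => z.1 * (endoBlockAt L S w (c w) * z.2) * z.1⁻¹) (Λw w)) :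
    ∃ K₀ : ℝ, 0 < K₀ ∧ ∀ fH : 𝔸[L] × 𝔹[L] → ℂ, Continuous fH → ∀ c : {w : InfinitePlace L // IsComplex w} → Fin 3 → ℝ, c ∈ RegS S →
      archRH S c * chartOrbH L νH S fH c =
        (K₀ : ℂ) * (∏ w, (if w ∈ S then ((Real.exp (c w 0) : ℝ) : ℂ) else 1 - (Circle.exp (c w 2 - c w 0) : ℂ))) *
          ∫ z, fH ((archPiEquivCM 2 L Φ₂[L]).symm (fun w => (z w).1 * (endoBlockAt L S w (c w) * (z w).2) * (z w).1⁻¹), (endoTorus L S c).2)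
            ∂(Measure.pi Λw) := by
  -- instances at the places, on the quotients, on the chart tori
  letI : MeasurableSpace ((𝔸[L] × 𝔹[L]) ⧸ chartTorusH L S) := borel _
  haveI : BorelSpace ((𝔸[L] × 𝔹[L]) ⧸ chartTorusH L S) := ⟨rfl⟩
  haveI : ∀ w, SigmaFinite (chartHaarHLoc L S w) := fun w => sigmaFinite_chartHaarHLoc L S w
  haveI : νB.IsInvInvariant := isInvInvariant_of_isHaarMeasure_archOne L νB
  haveI := locallyCompactSpace_chartTorusH L S
  -- the product-quotient package
  obtain ⟨ρ, hρH, hρI, -, hcov, -⟩ := exists_haar_quotientMeasure_prod_pi_top (archPiEquivCM 2 L Φ₂[L])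
    (fun w => chartTorusHLoc L S w) (fun w => isClosed_chartTorusHLoc L S w) (chartTorusH L S) (isClosed_chartTorusH L S)
    (mem_chartTorusH_iff_forall_mem_chartTorusHLoc L S) (fun w => chartHaarHLoc L S w) νw νB νH hν
  have hK₀pos : 0 < (ρ (chartBoxImg L S)).toReal * ∏ w, (Cw w : ℝ) := by
    refine mul_pos (ENNReal.toReal_pos (measure_chartBoxImg_pos L S ρ).ne' ((isCompact_chartBoxImg L S).measure_lt_top (μ := ρ)).ne) ?_
    exact Finset.prod_pos fun w _ => NNReal.coe_pos.2 (pos_iff_ne_zero.2 (hCw w))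
  refine ⟨(ρ (chartBoxImg L S)).toReal * ∏ w, (Cw w : ℝ), hK₀pos, fun fH hfH c hc => ?_⟩
  have hc1 : ∀ w, w ∈ S → c w 0 ≠ 0 := ((mem_regS_iff S c).1 hc).2
  -- (1) Haar-freeness + the package
  have hint : ∫ y, descConj (endoTorus L S c) (chartTorusH L S) (forall_mem_chartTorusH_comm L S c) fH y
      ∂(quotientMeasure (chartTorusH L S) ρ (isClosed_chartTorusH L S) νH) =
      ∫ p, fH ((archPiEquivCM 2 L Φ₂[L]).symm (fun w => descConj (endoBlockAt L S w (c w)) (chartTorusHLoc L S w)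
        (forall_mem_chartTorusHLoc_comm L S w (c w)) id (p w)), (endoTorus L S c).2)
        ∂(Measure.pi fun w => quotientMeasure (chartTorusHLoc L S w) (chartHaarHLoc L S w) (isClosed_chartTorusHLoc L S w) (νw w)) :=
    hcov (fun w => endoBlockAt L S w (c w)) (endoTorus L S c).2 (fun w => forall_mem_chartTorusHLoc_comm L S w (c w))
      (forall_mem_chartTorusH_comm L S c) fH
  -- (2) the orbital measures of the places and their leaves (`m w` the leaf parametrisation, `Φ` the integrand on `Π_w G_w`, `dsc` the scalars)
  let m : ∀ w : {w : InfinitePlace L // IsComplex w}, ↥(archLocal L 2 Φ₂[L] w) × ↥(archLocal L 2 Φ₂[L] w) → ↥(archLocal L 2 Φ₂[L] w) :=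
    fun w z => z.1 * (endoBlockAt L S w (c w) * z.2) * z.1⁻¹
  have hm_c : ∀ w, Continuous (m w) := fun w => (continuous_fst.mul (continuous_const.mul continuous_snd)).mul continuous_fst.inv
  let Φ : (∀ w : {w : InfinitePlace L // IsComplex w}, ↥(archLocal L 2 Φ₂[L] w)) → ℂ :=
    fun g => fH ((archPiEquivCM 2 L Φ₂[L]).symm g, (endoTorus L S c).2)
  have hΦ_c : Continuous Φ := hfH.comp (((archPiEquivCM 2 L Φ₂[L]).symm.continuous).prodMk continuous_const)
  let dsc : {w : InfinitePlace L // IsComplex w} → ℝ≥0 := fun w => Cw w * (if w ∈ S then ‖(((Real.exp (-2 * c w 0) : ℝ) : ℂ)) - 1‖₊⁻¹ else 1)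
  have hD_c : Continuous (fun (p : ∀ w : {w : InfinitePlace L // IsComplex w}, ↥(archLocal L 2 Φ₂[L] w) ⧸ chartTorusHLoc L S w)
      (w : {w : InfinitePlace L // IsComplex w}) =>
      descConj (endoBlockAt L S w (c w)) (chartTorusHLoc L S w) (forall_mem_chartTorusHLoc_comm L S w (c w)) id (p w)) :=
    continuous_pi fun w => (continuous_descConj (endoBlockAt L S w (c w)) (chartTorusHLoc L S w) _ continuous_id).comp (continuous_apply w)
  have hM_c : Continuous (fun (z : ∀ w : {w : InfinitePlace L // IsComplex w}, ↥(archLocal L 2 Φ₂[L] w) × ↥(archLocal L 2 Φ₂[L] w))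
      (w : {w : InfinitePlace L // IsComplex w}) => m w (z w)) :=
    continuous_pi fun w => (hm_c w).comp (continuous_apply w)
  have hO : ∀ w, (quotientMeasure (chartTorusHLoc L S w) (chartHaarHLoc L S w) (isClosed_chartTorusHLoc L S w) (νw w)).map
      (descConj (endoBlockAt L S w (c w)) (chartTorusHLoc L S w) (forall_mem_chartTorusHLoc_comm L S w (c w)) id) = dsc w • (Λw w).map (m w) :=
    fun w => hleaf w c (hc1 w)
  -- the leaf images are finite on compacta (properness at the single point `c`), hence σ-finite
  have hmfin : ∀ w, IsFiniteMeasureOnCompacts ((Λw w).map (m w)) := by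
    intro w
    exact isFiniteMeasureOnCompacts_map_of_leaf_pos (Λw w) (hZnull w) (hm_c w) fun C' hC' => hprop w c hc C' hC'
  haveI : ∀ w, SigmaFinite ((Λw w).map (m w)) := fun w => by haveI := hmfin w; infer_instance
  haveI : ∀ w, SigmaFinite ((quotientMeasure (chartTorusHLoc L S w) (chartHaarHLoc L S w) (isClosed_chartTorusHLoc L S w) (νw w)).map
      (descConj (endoBlockAt L S w (c w)) (chartTorusHLoc L S w) (forall_mem_chartTorusHLoc_comm L S w (c w)) id)) := fun w => by
    rw [hO w]; haveI := hmfin w; infer_instance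
  -- (3) assemble: package → image of the product of quotient measures → product of leaves → fold
  have hstep : ∫ p, fH ((archPiEquivCM 2 L Φ₂[L]).symm (fun w => descConj (endoBlockAt L S w (c w)) (chartTorusHLoc L S w)
        (forall_mem_chartTorusHLoc_comm L S w (c w)) id (p w)), (endoTorus L S c).2)
        ∂(Measure.pi fun w => quotientMeasure (chartTorusHLoc L S w) (chartHaarHLoc L S w) (isClosed_chartTorusHLoc L S w) (νw w)) =
      (∏ w, dsc w) • ∫ z, fH ((archPiEquivCM 2 L Φ₂[L]).symm (fun w => (z w).1 * (endoBlockAt L S w (c w) * (z w).2) * (z w).1⁻¹), (endoTorus L S c).2)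
        ∂(Measure.pi Λw) := by
    -- as an integral of `Φ` against the image measure, then `pi_map_pi`, the leaves, `pi_nnreal_smul_map`, and the fold
    have h1 : (fun p : (∀ w : {w : InfinitePlace L // IsComplex w}, ↥(archLocal L 2 Φ₂[L] w) ⧸ chartTorusHLoc L S w) =>
        fH ((archPiEquivCM 2 L Φ₂[L]).symm (fun w => descConj (endoBlockAt L S w (c w)) (chartTorusHLoc L S w)
          (forall_mem_chartTorusHLoc_comm L S w (c w)) id (p w)), (endoTorus L S c).2)) =
        fun p => Φ (fun w => descConj (endoBlockAt L S w (c w)) (chartTorusHLoc L S w) (forall_mem_chartTorusHLoc_comm L S w (c w)) id (p w)) := rfl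
    rw [h1, ← integral_map hD_c.measurable.aemeasurable hΦ_c.aestronglyMeasurable,
      Measure.pi_map_pi (fun w => (continuous_descConj (endoBlockAt L S w (c w)) (chartTorusHLoc L S w) _ continuous_id).measurable.aemeasurable)]
    have h2 : (Measure.pi fun w => (quotientMeasure (chartTorusHLoc L S w) (chartHaarHLoc L S w) (isClosed_chartTorusHLoc L S w) (νw w)).map
        (descConj (endoBlockAt L S w (c w)) (chartTorusHLoc L S w) (forall_mem_chartTorusHLoc_comm L S w (c w)) id)) =
        Measure.pi fun w => dsc w • (Λw w).map (m w) := congrArg Measure.pi (funext hO)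
    rw [h2, pi_nnreal_smul_map Λw m (fun w => (hm_c w).measurable) dsc, integral_smul_nnreal_measure,
      integral_map hM_c.measurable.aemeasurable hΦ_c.aestronglyMeasurable]
  -- (4) scalars
  rw [chartOrbH_eq_of_isHaarMeasure L S νH ρ fH c]
  show archRH S c * (((ρ (chartBoxImg L S)).toReal : ℂ) * ∫ y, descConj (endoTorus L S c) (chartTorusH L S) (forall_mem_chartTorusH_comm L S c) fH y
      ∂(quotientMeasure (chartTorusH L S) ρ (isClosed_chartTorusH L S) νH)) = _
  rw [hint, hstep]
  have hfac : ∀ w, (if w ∈ S then ((|Real.exp (c w 0) - Real.exp (-c w 0)| : ℝ) : ℂ) else 1 - (Circle.exp (c w 2 - c w 0) : ℂ)) * ((dsc w : ℝ) : ℂ) =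
      ((Cw w : ℝ) : ℂ) * (if w ∈ S then ((Real.exp (c w 0) : ℝ) : ℂ) else 1 - (Circle.exp (c w 2 - c w 0) : ℂ)) := by
    intro w
    by_cases hw : w ∈ S
    · simp only [dsc, if_pos hw, NNReal.coe_mul, NNReal.coe_inv, coe_nnnorm, Complex.ofReal_mul, Complex.ofReal_inv]
      have h := abs_exp_sub_exp_neg_mul_norm_inv (c w 0) (hc1 w hw)
      calc ((|Real.exp (c w 0) - Real.exp (-c w 0)| : ℝ) : ℂ) * (((Cw w : ℝ) : ℂ) * (((‖(((Real.exp (-2 * c w 0) : ℝ) : ℂ)) - 1‖ : ℝ) : ℂ))⁻¹)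
          = ((Cw w : ℝ) : ℂ) * (((|Real.exp (c w 0) - Real.exp (-c w 0)| * ‖(((Real.exp (-2 * c w 0) : ℝ) : ℂ)) - 1‖⁻¹ : ℝ)) : ℂ) := by
            push_cast; ring
        _ = ((Cw w : ℝ) : ℂ) * ((Real.exp (c w 0) : ℝ) : ℂ) := by rw [h]
    · simp only [dsc, if_neg hw, mul_one]
      ring
  have harch : archRH S c = ∏ w, (if w ∈ S then ((|Real.exp (c w 0) - Real.exp (-c w 0)| : ℝ) : ℂ) else 1 - (Circle.exp (c w 2 - c w 0) : ℂ)) := by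
    unfold archRH
    exact Finset.prod_congr rfl fun w _ => by congr 1
  rw [NNReal.smul_def, Complex.real_smul, NNReal.coe_prod, Complex.ofReal_prod, harch, Complex.ofReal_mul, Complex.ofReal_prod]
  have hprod : (∏ w, (if w ∈ S then ((|Real.exp (c w 0) - Real.exp (-c w 0)| : ℝ) : ℂ) else 1 - (Circle.exp (c w 2 - c w 0) : ℂ))) * ∏ w, ((dsc w : ℝ) : ℂ) =
      (∏ w, ((Cw w : ℝ) : ℂ)) * ∏ w, (if w ∈ S then ((Real.exp (c w 0) : ℝ) : ℂ) else 1 - (Circle.exp (c w 2 - c w 0) : ℂ)) := by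
    rw [← Finset.prod_mul_distrib, ← Finset.prod_mul_distrib]
    exact Finset.prod_congr rfl fun w _ => hfac w
  calc (∏ w, (if w ∈ S then ((|Real.exp (c w 0) - Real.exp (-c w 0)| : ℝ) : ℂ) else 1 - (Circle.exp (c w 2 - c w 0) : ℂ))) *
        (((ρ (chartBoxImg L S)).toReal : ℂ) * ((∏ w, ((dsc w : ℝ) : ℂ)) *
          ∫ z, fH ((archPiEquivCM 2 L Φ₂[L]).symm (fun w => (z w).1 * (endoBlockAt L S w (c w) * (z w).2) * (z w).1⁻¹), (endoTorus L S c).2)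
            ∂(Measure.pi Λw)))
      = ((ρ (chartBoxImg L S)).toReal : ℂ) * (((∏ w, (if w ∈ S then ((|Real.exp (c w 0) - Real.exp (-c w 0)| : ℝ) : ℂ) else 1 - (Circle.exp (c w 2 - c w 0) : ℂ))) *
          ∏ w, ((dsc w : ℝ) : ℂ)) *
          ∫ z, fH ((archPiEquivCM 2 L Φ₂[L]).symm (fun w => (z w).1 * (endoBlockAt L S w (c w) * (z w).2) * (z w).1⁻¹), (endoTorus L S c).2)
            ∂(Measure.pi Λw)) := by ring
    _ = _ := by rw [hprod]; ring


end AssemblyPos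

/-! ## §2 The same for an arbitrary Haar measure `νH` -/

section AnyHaarPos

variable (L : Type) [Field L] [NumberField L] [IsCMField L] (S : Finset {w : InfinitePlace L // IsComplex w})
  [∀ w : {w : InfinitePlace L // IsComplex w}, MeasurableSpace ↥(archLocal L 2 Φ₂[L] w)]
  [∀ w : {w : InfinitePlace L // IsComplex w}, BorelSpace ↥(archLocal L 2 Φ₂[L] w)]
  [∀ w : {w : InfinitePlace L // IsComplex w}, LocallyCompactSpace ↥(archLocal L 2 Φ₂[L] w)]
  [∀ w : {w : InfinitePlace L // IsComplex w}, SecondCountableTopology ↥(archLocal L 2 Φ₂[L] w)]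
  [∀ w : {w : InfinitePlace L // IsComplex w}, MeasurableSpace (↥(archLocal L 2 Φ₂[L] w) ⧸ chartTorusHLoc L S w)]
  [∀ w : {w : InfinitePlace L // IsComplex w}, BorelSpace (↥(archLocal L 2 Φ₂[L] w) ⧸ chartTorusHLoc L S w)]
  [∀ w : {w : InfinitePlace L // IsComplex w}, (chartHaarHLoc L S w).IsHaarMeasure]
  [∀ w : {w : InfinitePlace L // IsComplex w}, (chartHaarHLoc L S w).IsInvInvariant]
  [MeasurableSpace 𝔸[L]] [BorelSpace 𝔸[L]] [MeasurableSpace 𝔹[L]] [BorelSpace 𝔹[L]]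
  (νw : ∀ w : {w : InfinitePlace L // IsComplex w}, Measure ↥(archLocal L 2 Φ₂[L] w)) [∀ w, (νw w).IsHaarMeasure] [∀ w, (νw w).IsMulRightInvariant]
  (νH : Measure (𝔸[L] × 𝔹[L])) [νH.IsHaarMeasure] [νH.IsMulRightInvariant]

/-- **UNIFORM UNFOLDING FOR GIVEN LEAVES, ARBITRARY HAAR MEASURE `νH`, WITH A POSITIVE CONSTANT** (★ `chartOrbH_eq_haarScalarFactor_mul` absorbs the Haar scalar
`haarScalarFactor νH ν₀ > 0` into `K₀`, ★ `haarScalarFactor_pos_of_isHaarMeasure`). [cite: Folland1995, §2.2; §2.6 (2.52)] [cite: Varadarajan1989, §6.4 Lemma 21, Thm 23] -/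
theorem exists_pos_archRH_mul_chartOrbH_eq_of_placeLeaves_of_isHaarMeasure
    (Λw : ∀ w : {w : InfinitePlace L // IsComplex w}, Measure (↥(archLocal L 2 Φ₂[L] w) × ↥(archLocal L 2 Φ₂[L] w))) [∀ w, IsFiniteMeasureOnCompacts (Λw w)]
    (Zw : ∀ w : {w : InfinitePlace L // IsComplex w}, Set (↥(archLocal L 2 Φ₂[L] w) × ↥(archLocal L 2 Φ₂[L] w))) (hZnull : ∀ w, Λw w (Zw w)ᶜ = 0)
    (Cw : {w : InfinitePlace L // IsComplex w} → ℝ≥0) (hCw : ∀ w, Cw w ≠ 0)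
    (hprop : ∀ (w) (c : {w : InfinitePlace L // IsComplex w} → Fin 3 → ℝ), c ∈ RegS S → ∀ C' : Set ↥(archLocal L 2 Φ₂[L] w), IsCompact C' →
      ∃ 𝒮 : Set (↥(archLocal L 2 Φ₂[L] w) × ↥(archLocal L 2 Φ₂[L] w)), IsCompact 𝒮 ∧ ∀ z ∈ Zw w, z.1 * (endoBlockAt L S w (c w) * z.2) * z.1⁻¹ ∈ C' → z ∈ 𝒮)
    (hleaf : ∀ (w) (c : {w : InfinitePlace L // IsComplex w} → Fin 3 → ℝ), (w ∈ S → c w 0 ≠ 0) →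
      Measure.map (descConj (endoBlockAt L S w (c w)) (chartTorusHLoc L S w) (forall_mem_chartTorusHLoc_comm L S w (c w)) id)
          (quotientMeasure (chartTorusHLoc L S w) (chartHaarHLoc L S w) (isClosed_chartTorusHLoc L S w) (νw w)) =
        (Cw w * (if w ∈ S then ‖(((Real.exp (-2 * c w 0) : ℝ) : ℂ)) - 1‖₊⁻¹ else 1)) •
          Measure.map (fun z : ↥(archLocal L 2 Φ₂[L] w) × ↥(archLocal L 2 Φ₂[L] w) => z.1 * (endoBlockAt L S w (c w) * z.2) * z.1⁻¹) (Λw w)) :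
    ∃ K₀ : ℝ, 0 < K₀ ∧ ∀ fH : 𝔸[L] × 𝔹[L] → ℂ, Continuous fH → ∀ c : {w : InfinitePlace L // IsComplex w} → Fin 3 → ℝ, c ∈ RegS S →
      archRH S c * chartOrbH L νH S fH c =
        (K₀ : ℂ) * (∏ w, (if w ∈ S then ((Real.exp (c w 0) : ℝ) : ℂ) else 1 - (Circle.exp (c w 2 - c w 0) : ℂ))) *
          ∫ z, fH ((archPiEquivCM 2 L Φ₂[L]).symm (fun w => (z w).1 * (endoBlockAt L S w (c w) * (z w).2) * (z w).1⁻¹), (endoTorus L S c).2)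
            ∂(Measure.pi Λw) := by
  obtain ⟨νB, hνB⟩ : ∃ νB : Measure 𝔹[L], νB.IsHaarMeasure := ⟨Measure.haar, inferInstance⟩
  haveI := hνB
  haveI : νB.IsMulRightInvariant := (forall_measure_preimage_mul_right_iff νB).1 fun g A _ => by
    have h : (fun h : 𝔹[L] => h * g) = fun h => g * h := funext fun h => archOne_mul_comm L h g
    rw [h, measure_preimage_mul]
  haveI := isHaarMeasure_prodConventionH L νw νB
  haveI := isMulRightInvariant_prodConventionH L νw νB
  obtain ⟨K₀, hK₀, hid⟩ := exists_pos_archRH_mul_chartOrbH_eq_of_placeLeaves L S νw νB (((Measure.pi νw).map (archPiEquivCM 2 L Φ₂[L]).symm).prod νB) rfl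
    Λw Zw hZnull Cw hCw hprop hleaf
  refine ⟨haarScalarFactor νH (((Measure.pi νw).map (archPiEquivCM 2 L Φ₂[L]).symm).prod νB) * K₀,
    mul_pos (NNReal.coe_pos.2 (haarScalarFactor_pos_of_isHaarMeasure _ _)) hK₀, fun fH hfH c hc => ?_⟩
  rw [chartOrbH_eq_haarScalarFactor_mul L S νH (((Measure.pi νw).map (archPiEquivCM 2 L Φ₂[L]).symm).prod νB) fH c, ← mul_assoc,
    mul_comm (archRH S c), mul_assoc, hid fH hfH c hc, Complex.ofReal_mul]
  ring

end AnyHaarPos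

end Literature.NumberTheory.Automorphic.UnitaryGroup

end
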